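/-
Copyright: statement-level skeleton of a published paper (lit-balaban cell, Phase-2 proof seat p26 gen 47). No claims beyond
what the kernel checks below.
-/
import Mathlib
import Literature.MathematicalPhysics.QuantumFieldTheory.Balaban1983to89.B3Prop21ZeroBackground

/-!
# B3 — T. Bałaban, *(Higgs)₂,₃ quantum fields in a finite volume. III. Renormalization*, CMP **88** (1983) 411–445
[Balaban1983Higgs3] — pp. 424–426 [PDF 14–16]: **THE HYPOTHESIS OF PROPOSITION 2.1 READ ON THE GRAPH, NOT ON THE ORDERINGS** — print
assumes that *"each connected subgraph"* of `G` *"has a positive degree"* and USES, for a fixed ordering `l̃` of the lines, that the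
subgraphs *"G₁, G₂, …, G_m"* built along `l̃` (p. 425) — more exactly their connected components `G_i^{(α)}` — *"have positive degrees"*
(p. 426).  The bridge between the two is the combinatorial fact that EVERY COMPONENT OF EVERY `G_i` ALONG EVERY ORDERING IS A
CONNECTED SUBGRAPH OF `G` (a nonempty set of lines together with its endpoint vertices, connected by those lines), and that gen-2's
degree `D` of the component ((2.2) in Proposition 2.2 generality: `Σ_{v}(d + e_v) − d + Σ_{l} a_l`) is the generalized degree of that
subgraph.  This file PROVES it for every model of gen-2's class (`B3Ineq215.Model`, the blocks `fiber`∕`before` of `B3Ineq215Quotient`)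
and derives FILE 22's per-ordering hypothesis `PosDegAlong` from the ORDERING-FREE hypothesis "every nonempty connected set of lines of
`G` has positive generalized degree" — FILE 23 of the Feynman-rule evaluator lineage.  v1.1 (§3) adds THE INCIDENCE DICTIONARY:
print's vertex degree (2.1) with the incidences taken relative to a set of lines `E` (`vdeg`), the identity "generalized degree of `E` with
FILE 20's η-powers and FILE 21's line dimensions = `Σ_{v ∈ verts E} D_E(v) − d` + output-pair dimensions" ((2.2) of the subgraph spanned
by `E`, for graphs without the vertices (1.14), (1.15)), hence print's hypothesis IN PRINT'S CURRENCY ⇒ `PosDegAlong`; and, at `E` = all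
lines, the recovery of p18's whole-graph incidence counts, vertex degree (2.1) and degree (2.2) (`B3Cor23Concrete.Graph.intScalar`,
`intVector`, `intDiffs`, `vertexDeg`, `deg`); v1.2 (§3c) writes `vdeg` AS r15's verbatim (2.1) `B3Sect2Statements.degreeIn` fed with
the incidence record relative to `E` (`incidenceOf`, bounds `intS ≤ scalarLegs`, `intV ≤ vectorLegs`, `intD ≤ diffCount`; at `E` = all lines
= p18's `Graph.incidence`).

statement-level skeleton of published theorems with citation tags; proofs where landed; nothing here is a claim about
the Yang–Mills mass gap

PDF held: `paper:balaban1983-higgs-2-3-quantum-fields-finite-volume` (journal page = PDF page + 410); pp. 424–426 [PDF 14–16] read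
by this seat on the text layer (2026-08-25).

CITATION HEADER (lean-in-tree rule).  lit-balaban TYPED SKELETON (HOME `run/shared/lean/pub/lit-balaban/`), PHASE 2, seat p26 gen 47
(unit `lit-balaban-p26`; free-target protocol G.5-34(d), own lane; item (P) of `HOME/lit-balaban-p26/DESIGN-B3-evaluator.md` § g47).
ROWS **B3.Prop2.1** (hypothesis of Proposition 2.1 p. 424), **B3.Eq2.15-2.16** (the components `G_i^{(α)}` of (2.16) p. 428), **B3.Eq2.2**
((2.2) p. 423), v1.1 also **B3.Eq2.1** ((2.1) p. 422) of `HOME/lit-balaban-r15/ROWS-B3.md` (fold owner r15; OPTIONAL located member, cells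
only, zero head weight).  CONSUMES BY NAME, nothing re-declared: gen-2's `B3Ineq215.Model` with `rep`, `reps`, `fiber`, `before`, `Nontriv`,
`D`, `bs`, `bt`, `rep_succ`, `rho_bs`, `rho_bt`, `rho_of_ne`, `rho_ne_bt`, `rep_succ_of_not_lt`, `rep_src_eq_rep_tgt`, `bs_mem_reps`,
`fiber_of_trivial`, `before_zero`, `fiber_succ_bs`, `fiber_succ_of_ne`, `before_succ_bs`, `before_succ_of_ne`, `mem_fiber`, `mem_before`;
FILE 22 `B3Prop21ZeroBackground` (`orderedModel`, `PosDegAlong`); FILE 12 (`Lines`, `lineSrc`, `lineTgt`, `modelOfGraph`); v1.1 (§3) also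
r15's `B3Prop1.VertexKind.{etaCount, isAveragingVertex, scalarLegs, diffCount}`, p18's `B3Cor23Concrete.Graph.{intScalar, intVector,
intDiffs, vertexDeg, vertexDeg_eq, deg, deg_eq, exists_line, other}`, FILE 2 `B3GraphAmplitude` (`Pairing.{Line, mate, other, isLower,
lower_xor, other_mate_of_isLower, mate_eq, isLower_iff}`, `SLeg`, `VLeg`, `sPairing`, `vPairing`, `spartner_eq_none_iff`,
`vpartner_eq_none_iff`, `sRank_injective`, `vRank_injective`), FILE 19 `B3Ineq213TorusBlocksSigned.isDiffLeg`, FILE 20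
`B3Ineq213VertexBounds.{extraEta, extraEta_eq}`, FILE 21 `B3Ineq213ZeroBackground.{nDiff, lineDim}`, p19's `B3Ineq213.LinesConnect`;
v1.2 (§3c) also r15's `B3Sect2Statements.{Incidence, degreeIn}`, `B3VertexBridge.toCounts`, p18's `Graph.{incidence, intScalar_le,
intVector_le, intDiffs_le}`.
PARALLEL IN THE TREE (declared): p19's `B3Prop21Instance.hpos_of_posSubgraphs` and p18's `B3Eq320PositiveSubgraphs` READ print's
hypothesis on the components along the orderings (the tree's convention, and print's own phrase p. 445: *"each of its subgraphs
appearing within some ordering has positive degree"*); this file shows that the ordering-free reading implies that one.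

THE PRINTED TEXT (pp. 422–426, 428, 445; the sentences as printed).  p. 422: *"We define a degree D_G(v) of a vertex v in a graph G in
the following way: D_G(v) = (the number of factors η in v) + (the number of legs of scalar or vector fields in v belonging to internal lines
of the graph G)·(−d+2)∕2 − (the number of differentiations in v acting on internal lines of the graph G) + [the number of legs of vector
fields in v belonging to internal lines of the graph G in the case when v is a vertex of the form (1.14) and (1.15)]. (2.1)"*; p. 423: *"if
a graph G does not have the vertices of the form (1.7) …, then we define D(G) = Σ_{v ∈ G} D_G(v) − d (2.2). We take the same definition in
the case when mass renormalization counterterms are given by … δm²_fin or δm²_{K,k}"*.  p. 424: *"Proposition 2.1. Let G be a connected graph such that its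
each connected subgraph, with the possible exception of the subgraphs (2.4), has a positive degree."*; p. 425: *"For every such ordering
we define an increasing sequence of subgraphs G₁, G₂, …, G_m = G′ of the graph G in the following way: G₁ is formed by the line l(1) and
two vertices at the endpoints of this line, …, G_{i+1} is built by adding to the graph G_i the line l(i+1) and two vertices at the
endpoints of l(i+1) (if they do not belong to G_i already), …. In general the subgraphs G_i are not connected and we represent them as
sums of disjoint connected subgraphs: G_i = ⋃_α G_i^{(α)}. According to the assumption of the theorem, we have that either D(G_i^{(α)}) > 0,
or G_i^{(α)} is the graph (2.4)."*; p. 426: *"G₁, G₂, …, G_m = G′* defined as previously have positive degrees."*; p. 428: *"A graph G/G_i is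
defined as a graph obtained from G by shrinking all connected components G_i^{(α)} of G_i to points."*; p. 445: *"A graph of this set has
the property that each of its subgraphs appearing within some ordering has positive degree."*

WHY THIS FILE ∕ READING (declared).  In gen-2's model the component of `G_i` containing the vertex `b` (a representative, `rep i b = b`)
is the pair (`fiber i b` = the vertices `v` with `rep i v = b`, `before i b` = the lines `l(1), …, l(i)` whose endpoints have
representative `b`); it is a component `G_i^{(α)}` when `before i b ≠ ∅` (`Nontriv`), an untouched vertex otherwise; its degree is
`D i b = Σ_{v ∈ fiber}(d + e_v) − d + Σ_{l ∈ before} a_l`.  A SUBGRAPH in print's sense (*"formed by the line … and two vertices at the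
endpoints"*) is a set of lines `E` with its endpoint vertices `verts E`; it is connected when its lines connect its vertices; its
generalized degree is `Σ_{v ∈ verts E}(d + e_v) − d + Σ_{l ∈ E} a_l` (`lineSetDeg`).  §1 proves, by induction along the construction of
p. 425 (gen-2's `rep_succ`: shrinking `l(i+1)` merges the blocks of its endpoints), that for a component `fiber i b = verts (before i b)`
and that `before i b` connects it; hence `D i b = lineSetDeg (before i b)` and positivity of all nonempty connected line sets gives
positivity of all components, for every model — in particular for every ORDERED model of FILE 22 (§2: the line sets of the model listed
along `σ` are the images under `eL ∘ σ` of sets of lines of `G`, with the same vertices, degree and connectivity), i.e. `PosDegAlong`.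

WHAT IS TYPED ∕ PROVED (definitions with bodies + theorems; no `Prop` fact, no `sorry`; standard axioms).  §1 (any `B3Ineq215.Model`):
`verts`, `lineSetDeg`, `Adj`, `LConnected` (a line set with its endpoints; its generalized degree (2.2); connectedness by its lines),
`before_succ_of_not_lt`, `fiber_succ_of_not_lt`, `before_succ_bt_eq_empty`, **`block_subgraph`** (for `Nontriv i b`: every vertex of
`fiber i b` is an endpoint of a line of `before i b`, and `before i b` connects `fiber i b` — induction on `i`), `fiber_eq_verts_before`,
**`D_eq_lineSetDeg`** (`D i b = lineSetDeg (before i b)`), `lconnected_before`, **`pos_blocks_of_forall_lineSets`**; §2 (p18's graphs):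
`gverts`, `gdeg`, `GAdj`, `GConnected` (the same notions for sets of lines of `Lines G Po`), `verts_orderedModel`,
`lineSetDeg_orderedModel`, `lconnected_orderedModel_iff`, **`posDegAlong_of_forall_connected`** (the ordering-free hypothesis *"each
connected subgraph has a positive degree"*, in gen-2's generalized-degree currency with `e_v`, `a_l`, implies FILE 22's `PosDegAlong`
for every enumeration `eL`).  §3 (v1.1, p18's graphs; THE INCIDENCE DICTIONARY): `sInc`, `vInc`, `dInc`, `intS`, `intV`, `intD` (the
φ′-legs, A′-legs and differentiations of a vertex on a line ∕ on the lines of a set `E`, read through FILE 12's lines and FILE 19's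
differentiated legs), **`vdeg`** (print's (2.1) with the incidences relative to `E`, the (1.14) ∕ (1.15) bracket included), `outDim`,
`sum_inc_eq_lineDim` (FILE 21's `lineDim l` is the sum of the line's contributions to the degrees (2.1) of its endpoints),
**`gdeg_eq_sum_vdeg`** (no vertices (1.14), (1.15): `gdeg extraEta (lineDim d a_o) d E = Σ_{v ∈ verts E} vdeg E v − d + Σ_{o ∈ E} a_o(o)`),
**`posDegAlong_of_forall_connected_printed`** (print's hypothesis in print's currency ⇒ FILE 22's `PosDegAlong`); §3b (`E` = all lines):
`sum_line_ends` (for one species: lower endpoint + mate over all lines = all internal legs), `intS_univ`, `intV_univ`, `intD_univ`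
(= p18's `intScalar`, `intVector`, `intDiffs`), **`vdeg_univ`** (`vdeg Po d univ v = Graph.vertexDeg d v`), **`sum_vdeg_univ_sub`**
(`Σ_v vdeg − d = Graph.deg d`), `lines_nonempty`, `exists_endpoint_of_linesConnect`, `gverts_univ_of_linesConnect`, **`gdeg_univ_eq_deg`**
(connected, no (1.14) ∕ (1.15): `gdeg extraEta (lineDim d a_o) d univ = Graph.deg d + Σ_o a_o(o)`); §3c (v1.2): `intS_mono`, `intV_mono`,
`intD_mono`, `intS_le_scalarLegs`, `intV_le_vectorLegs`, `intD_le_diffCount`, **`incidenceOf`** (r15's `Incidence (toCounts d κ_v)` relative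
to `E`), **`vdeg_eq_degreeIn`** (`vdeg Po d E v = degreeIn d (toCounts d κ_v) (incidenceOf Po d E v)`), `incidenceOf_univ` (= p18's
`Graph.incidence`).
HONEST SCOPE.  (a) Degrees in §1–§2 are the GENERALIZED degrees of Proposition 2.2 ∕ (2.14) (`e_v`, `a_l` supplied: in FILE 22 `extraEta`
and `lineDim`); §3 identifies them, for those `e_v`, `a_l` and graphs WITHOUT the vertices (1.14), (1.15) (FILE 21 ∕ 22's standing hypothesis
`isAveragingVertex = false`: FILE 21's `lineDim` gives every A′-leg the dimension `−(d−2)∕2`, not print's `−(d−2)∕2 + 1` at those vertices),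
with the printed (2.1)–(2.2) degree of the subgraph spanned by the line set, and at `E` = all lines with p18's `B3Cor23Concrete.Graph.deg`;
NOT done: the counterterm summand of (2.3) for `δm²_k` (p18's attached-form convention gives the vertices (1.7) counterterm degree 0, as
print does for `δm²_fin`, `δm²_{K,k}`).  (b) Only the direction print
uses is proved (connected subgraphs positive ⇒ components along orderings positive); the converse (every nonempty connected line set is a
component along some ordering) is not needed and not proved.  (c) The exception (2.4) and the integration by parts (2.8)–(2.9) are not
treated (p19's `B3Prop21Except24*` for the abstract class).  (d) Pure combinatorics over gen-2's `B3Ineq215Quotient` ∕ `Degrees`; nothing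
analytic.  (e) For the DEGREE HYPOTHESIS of Proposition 2.1 the located gaps remaining in this lineage after this file are exactly the
residue of (a) (v1.0: the incidence dictionary to p18's `B3Cor23Concrete.deg`, (2.1)–(2.3) proper — DONE in v1.1 §3 up to the (2.3)
counterterm summand and the (1.14) ∕ (1.15) leg dimension) and (c) (the exception (2.4) ∕ integration by parts); the other hypotheses of
FILE 22's theorems (FILE 21's analytic and data hypotheses: external contractions, data sup norms, block configuration, connectedness of
`G`, zero background, no averaging vertices) are untouched by it.  (f) §3's incidences are those of the TREE'S vertex model: legs by FILE
12's pairings of p18's `Graph.other` (two legs per line; a line with both endpoints at `v` counts twice, as in p18's `intScalar`),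
differentiations by FILE 19's `isDiffLeg` = p18's `diffCount` on the first φ′-leg of (1.8), (1.9) (`isDiffLeg_toNat`); `vdeg` is the
printed (2.1) to the extent that model is (r15's `B3Prop1`, p18's `B3Cor23Concrete` module docstrings).  Unit `lit-balaban-p26` gen 47 (literature-prover-lit-balaban-p26-g47-0), HOME `run/shared/lean/pub/lit-balaban/`, 2026-08-25 (v1.0 p403648 ✓ 48558b702a87; v1.1 = v1.0's declarations verbatim +
header sentences + §3; v1.2 = v1.1 verbatim + header sentences + §3c).
-/

open Finset
open scoped BigOperators

namespace Literature.MathematicalPhysics.QuantumFieldTheory.Balaban1983to89.B3Prop21DegreeHypothesis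

open Literature.MathematicalPhysics.QuantumFieldTheory.Balaban1983to89.B3Cor23Concrete (Graph)
open Literature.MathematicalPhysics.QuantumFieldTheory.Balaban1983to89.B3GraphAmplitude
open Literature.MathematicalPhysics.QuantumFieldTheory.Balaban1983to89.B3GraphAmplitudePositionForm
open Literature.MathematicalPhysics.QuantumFieldTheory.Balaban1983to89.B3Prop21ZeroBackground

noncomputable section

/-! ## §1 The components of `G_i` are connected subgraphs, for every model of gen-2's class -/

section Blocks

variable {V : Type} [Fintype V] [DecidableEq V] {m : ℕ}

/-- **THE VERTICES OF A SET OF LINES**: the endpoints of its lines (p. 425: a subgraph *"formed by the line l(1) and two vertices at the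
endpoints of this line"*, *"adding … the line l(i+1) and two vertices at the endpoints of l(i+1)"*). [cite: Balaban1983Higgs3, Prop. 2.1 p.425] -/
def verts (M : B3Ineq215.Model V m) (E : Finset (Fin m)) : Finset V :=
  E.biUnion fun l => {M.src l, M.tgt l}

/-- **THE GENERALIZED DEGREE (2.2) OF A SET OF LINES WITH ITS ENDPOINT VERTICES**: `Σ_{v ∈ verts E}(d + e_v) − d + Σ_{l ∈ E} a_l`
(gen-2's `Model.D` is this expression for the blocks `fiber i b`, `before i b`). [cite: Balaban1983Higgs3, (2.2) p.423]
[cite: Balaban1983Higgs3, (2.14) p.427] -/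
def lineSetDeg (M : B3Ineq215.Model V m) (E : Finset (Fin m)) : ℝ :=
  (∑ v ∈ verts M E, ((M.d : ℝ) + M.e v)) - M.d + ∑ l ∈ E, M.a l

/-- Adjacency through a line of the set `E`. [cite: Balaban1983Higgs3, Prop. 2.1 p.424] -/
def Adj (M : B3Ineq215.Model V m) (E : Finset (Fin m)) (a c : V) : Prop :=
  ∃ l ∈ E, M.src l = a ∧ M.tgt l = c

/-- **A CONNECTED SET OF LINES** (*"connected subgraph"*, p. 424): its lines connect its endpoint vertices.
[cite: Balaban1983Higgs3, Prop. 2.1 p.424] -/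
def LConnected (M : B3Ineq215.Model V m) (E : Finset (Fin m)) : Prop :=
  ∀ u ∈ verts M E, ∀ w ∈ verts M E, Relation.EqvGen (Adj M E) u w

variable (M : B3Ineq215.Model V m)

/-- Membership in the vertex set of a line set. [cite: Balaban1983Higgs3, Prop. 2.1 p.425] -/
theorem mem_verts {E : Finset (Fin m)} {v : V} : v ∈ verts M E ↔ ∃ l ∈ E, M.src l = v ∨ M.tgt l = v := by
  unfold verts
  simp only [mem_biUnion, mem_insert, mem_singleton]
  constructor
  · rintro ⟨l, hl, h⟩
    exact ⟨l, hl, by rcases h with h | h <;> [exact Or.inl h.symm; exact Or.inr h.symm]⟩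
  · rintro ⟨l, hl, h⟩
    exact ⟨l, hl, by rcases h with h | h <;> [exact Or.inl h.symm; exact Or.inr h.symm]⟩

/-- The first endpoint of a line of `E` is a vertex of `E`. [cite: Balaban1983Higgs3, Prop. 2.1 p.425] -/
theorem src_mem_verts {E : Finset (Fin m)} {l : Fin m} (hl : l ∈ E) : M.src l ∈ verts M E :=
  (mem_verts M).2 ⟨l, hl, Or.inl rfl⟩

/-- The second endpoint of a line of `E` is a vertex of `E`. [cite: Balaban1983Higgs3, Prop. 2.1 p.425] -/
theorem tgt_mem_verts {E : Finset (Fin m)} {l : Fin m} (hl : l ∈ E) : M.tgt l ∈ verts M E :=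
  (mem_verts M).2 ⟨l, hl, Or.inr rfl⟩

/-- The vertex set is monotone in the line set. [cite: Balaban1983Higgs3, Prop. 2.1 p.425] -/
theorem verts_mono {E E' : Finset (Fin m)} (h : E ⊆ E') : verts M E ⊆ verts M E' := by
  intro v hv
  obtain ⟨l, hl, h'⟩ := (mem_verts M).1 hv
  exact (mem_verts M).2 ⟨l, h hl, h'⟩

/-- Connectedness through a smaller line set implies connectedness through a larger one. [cite: Balaban1983Higgs3, Prop. 2.1 p.424] -/
theorem eqvGen_mono {E E' : Finset (Fin m)} (h : E ⊆ E') {u w : V} (huw : Relation.EqvGen (Adj M E) u w) :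
    Relation.EqvGen (Adj M E') u w := by
  refine Relation.EqvGen.mono ?_ u w huw
  rintro a c ⟨l, hl, ha, hc⟩
  exact ⟨l, h hl, ha, hc⟩

/-- When there is no line `l(i+1)` (`i ≥ m`) the blocks do not change. [cite: Balaban1983Higgs3, (2.16) p.428] -/
theorem fiber_succ_of_not_lt {i : ℕ} (h : ¬ i < m) (b : V) : M.fiber (i + 1) b = M.fiber i b := by
  ext v
  rw [M.mem_fiber, M.mem_fiber, M.rep_succ_of_not_lt h]

/-- When there is no line `l(i+1)` (`i ≥ m`) the block lines do not change. [cite: Balaban1983Higgs3, (2.16) p.428] -/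
theorem before_succ_of_not_lt {i : ℕ} (h : ¬ i < m) (b : V) : M.before (i + 1) b = M.before i b := by
  ext l
  rw [M.mem_before, M.mem_before, M.rep_succ_of_not_lt h]
  have hl : (l : ℕ) < m := l.isLt
  constructor
  · rintro ⟨-, hr⟩; exact ⟨by omega, hr⟩
  · rintro ⟨-, hr⟩; exact ⟨by omega, hr⟩

/-- After shrinking `l(i+1)` with distinct endpoint blocks, the summed-out representative `bt` has no lines.
[cite: Balaban1983Higgs3, (2.16) p.428] -/
theorem before_succ_bt_eq_empty {i : ℕ} (h : i < m) (hne : M.bs i h ≠ M.bt i h) : M.before (i + 1) (M.bt i h) = ∅ := by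
  rw [Finset.eq_empty_iff_forall_notMem]
  intro l hl
  rw [M.mem_before, M.rep_succ h] at hl
  exact M.rho_ne_bt h hne _ hl.2

/-- **THE COMPONENTS OF `G_i` ARE CONNECTED SUBGRAPHS** (p. 425): for every `i` and every representative `b` with `before i b ≠ ∅`,
(1) every vertex of the block `fiber i b` is an endpoint of a line of `before i b`, and (2) the lines `before i b` connect the vertices of
the block — by induction along the construction *"G_{i+1} is built by adding to the graph G_i the line l(i+1) and two vertices at the
endpoints of l(i+1)"* (gen-2's `rep_succ`, `fiber_succ_bs`, `before_succ_bs`). [cite: Balaban1983Higgs3, Prop. 2.1 p.425]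
[cite: Balaban1983Higgs3, (2.16) p.428] -/
theorem block_subgraph : ∀ (i : ℕ) (b : V), M.Nontriv i b →
    (∀ v ∈ M.fiber i b, v ∈ verts M (M.before i b)) ∧
      (∀ u ∈ M.fiber i b, ∀ w ∈ M.fiber i b, Relation.EqvGen (Adj M (M.before i b)) u w)
  | 0, b, hn => by
      exfalso
      rcases hn with ⟨l, hl⟩
      rw [M.before_zero] at hl
      exact Finset.notMem_empty _ hl
  | i + 1, b, hn => by
      by_cases h : i < m
      · by_cases hbs : b = M.bs i h
        · subst hbs
          -- the merged block: vertices `fiber i bs ∪ fiber i bt`, lines `l(i+1)`, `before i bs`, `before i bt`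
          have hE : M.before i (M.bs i h) ⊆ M.before (i + 1) (M.bs i h) := by
            rw [M.before_succ_bs h]
            exact (Finset.subset_union_left).trans (Finset.subset_insert _ _)
          have hE' : M.before i (M.bt i h) ⊆ M.before (i + 1) (M.bs i h) := by
            rw [M.before_succ_bs h]
            exact (Finset.subset_union_right).trans (Finset.subset_insert _ _)
          have hli : (⟨i, h⟩ : Fin m) ∈ M.before (i + 1) (M.bs i h) := by
            rw [M.before_succ_bs h]; exact Finset.mem_insert_self _ _
          have hsrc : M.src ⟨i, h⟩ ∈ M.fiber i (M.bs i h) := M.mem_fiber.2 rfl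
          have htgt : M.tgt ⟨i, h⟩ ∈ M.fiber i (M.bt i h) := M.mem_fiber.2 rfl
          -- every vertex of the `bs`-part is joined to `src l(i+1)`, every vertex of the `bt`-part to `tgt l(i+1)`
          have joinS : ∀ u ∈ M.fiber i (M.bs i h),
              u ∈ verts M (M.before (i + 1) (M.bs i h)) ∧
                Relation.EqvGen (Adj M (M.before (i + 1) (M.bs i h))) u (M.src ⟨i, h⟩) := by
            intro u hu
            by_cases hn' : M.Nontriv i (M.bs i h)
            · obtain ⟨h1, h2⟩ := block_subgraph i (M.bs i h) hn'
              exact ⟨verts_mono M hE (h1 u hu), eqvGen_mono M hE (h2 u hu _ hsrc)⟩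
            · have hf := M.fiber_of_trivial (M.bs_mem_reps h) hn'
              rw [hf, Finset.mem_singleton] at hu hsrc
              have hu' : u = M.src ⟨i, h⟩ := hu.trans hsrc.symm
              rw [hu']
              exact ⟨src_mem_verts M hli, Relation.EqvGen.refl _⟩
          have joinT : ∀ w ∈ M.fiber i (M.bt i h),
              w ∈ verts M (M.before (i + 1) (M.bs i h)) ∧
                Relation.EqvGen (Adj M (M.before (i + 1) (M.bs i h))) w (M.tgt ⟨i, h⟩) := by
            intro w hw
            by_cases hn' : M.Nontriv i (M.bt i h)
            · obtain ⟨h1, h2⟩ := block_subgraph i (M.bt i h) hn'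
              exact ⟨verts_mono M hE' (h1 w hw), eqvGen_mono M hE' (h2 w hw _ htgt)⟩
            · have hf := M.fiber_of_trivial (M.bt_mem_reps h) hn'
              rw [hf, Finset.mem_singleton] at hw htgt
              have hw' : w = M.tgt ⟨i, h⟩ := hw.trans htgt.symm
              rw [hw']
              exact ⟨tgt_mem_verts M hli, Relation.EqvGen.refl _⟩
          -- hence every vertex of the merged block is joined to `src l(i+1)`
          have joinAll : ∀ u ∈ M.fiber (i + 1) (M.bs i h),
              u ∈ verts M (M.before (i + 1) (M.bs i h)) ∧
                Relation.EqvGen (Adj M (M.before (i + 1) (M.bs i h))) u (M.src ⟨i, h⟩) := by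
            intro u hu
            rw [M.fiber_succ_bs h, Finset.mem_union] at hu
            rcases hu with hu | hu
            · exact joinS u hu
            · obtain ⟨h1, h2⟩ := joinT u hu
              refine ⟨h1, Relation.EqvGen.trans _ _ _ h2 (Relation.EqvGen.symm _ _ ?_)⟩
              exact Relation.EqvGen.rel _ _ ⟨⟨i, h⟩, hli, rfl, rfl⟩
          refine ⟨fun v hv => (joinAll v hv).1, fun u hu w hw => ?_⟩
          exact Relation.EqvGen.trans _ _ _ (joinAll u hu).2 (Relation.EqvGen.symm _ _ (joinAll w hw).2)
        · by_cases hbt : b = M.bt i h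
          · -- `b = bt ≠ bs`: the block of `bt` has been emptied
            exfalso
            subst hbt
            have := before_succ_bt_eq_empty M h (Ne.symm hbs)
            rcases hn with ⟨l, hl⟩
            rw [this] at hl
            exact Finset.notMem_empty _ hl
          · -- an untouched block
            have hn' : M.Nontriv i b := by
              show (M.before i b).Nonempty
              rw [← M.before_succ_of_ne h hbs hbt]
              exact hn
            rw [M.fiber_succ_of_ne h hbs hbt, M.before_succ_of_ne h hbs hbt]
            exact block_subgraph i b hn'
      · have hn' : M.Nontriv i b := by
          show (M.before i b).Nonempty
          rw [← before_succ_of_not_lt M h b]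
          exact hn
        rw [fiber_succ_of_not_lt M h, before_succ_of_not_lt M h]
        exact block_subgraph i b hn'

/-- **A COMPONENT'S VERTEX SET IS THE ENDPOINT SET OF ITS LINES** (`fiber i b = verts (before i b)` for `Nontriv i b`).
[cite: Balaban1983Higgs3, Prop. 2.1 p.425] [cite: Balaban1983Higgs3, (2.16) p.428] -/
theorem fiber_eq_verts_before {i : ℕ} {b : V} (hn : M.Nontriv i b) : M.fiber i b = verts M (M.before i b) := by
  refine Finset.Subset.antisymm (fun v hv => (block_subgraph M i b hn).1 v hv) fun v hv => ?_
  obtain ⟨l, hl, h⟩ := (mem_verts M).1 hv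
  obtain ⟨hli, hr⟩ := M.mem_before.1 hl
  rcases h with h | h
  · exact M.mem_fiber.2 (h ▸ hr)
  · rw [M.mem_fiber, ← h, ← M.rep_src_eq_rep_tgt hli]
    exact hr

/-- **THE DEGREE OF A COMPONENT IS THE GENERALIZED DEGREE (2.2) OF THE SUBGRAPH IT IS** (`D i b = lineSetDeg (before i b)`).
[cite: Balaban1983Higgs3, (2.2) p.423] [cite: Balaban1983Higgs3, (2.16) p.428] -/
theorem D_eq_lineSetDeg {i : ℕ} {b : V} (hn : M.Nontriv i b) : M.D i b = lineSetDeg M (M.before i b) := by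
  unfold B3Ineq215.Model.D lineSetDeg
  rw [fiber_eq_verts_before M hn]

/-- **THE LINES OF A COMPONENT CONNECT IT** (`before i b` is a connected set of lines for `Nontriv i b`).
[cite: Balaban1983Higgs3, Prop. 2.1 p.425] -/
theorem lconnected_before {i : ℕ} {b : V} (hn : M.Nontriv i b) : LConnected M (M.before i b) := by
  intro u hu w hw
  rw [← fiber_eq_verts_before M hn] at hu hw
  exact (block_subgraph M i b hn).2 u hu w hw

/-- **PRINT'S HYPOTHESIS ⇒ THE PER-COMPONENT HYPOTHESIS OF (2.15)∕(2.16)**: if every nonempty connected set of lines (with its endpoint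
vertices) has positive generalized degree, then every component of every `G_i` has positive degree `D` — gen-2's `hpos` of
`ineq215_of_pos`, for the given listing of the lines. [cite: Balaban1983Higgs3, Prop. 2.1 p.424] [cite: Balaban1983Higgs3, (2.16) p.428] -/
theorem pos_blocks_of_forall_lineSets
    (H : ∀ E : Finset (Fin m), E.Nonempty → LConnected M E → 0 < lineSetDeg M E) :
    ∀ i, i ≤ m → ∀ b ∈ M.reps i, M.Nontriv i b → 0 < M.D i b := by
  intro i _ b _ hn
  rw [D_eq_lineSetDeg M hn]
  exact H _ hn (lconnected_before M hn)

end Blocks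

/-! ## §2 On p18's graphs: the ordering-free hypothesis implies FILE 22's `PosDegAlong` -/

section Graphs

variable {nbar : ℕ} {G : Graph nbar}

/-- The endpoint vertices of a set of lines of a graph of p18's model (with its output pairing). [cite: Balaban1983Higgs3, Prop. 2.1 p.425] -/
def gverts (Po : OutPairing G) (E : Finset (Lines G Po)) : Finset (Fin G.nV) :=
  E.biUnion fun l => {lineSrc Po l, lineTgt Po l}

/-- The generalized degree (2.2)∕(2.14) of a set of lines with its endpoint vertices, for supplied η-powers `e_v` and line dimensions
`a_l`: `Σ_{v}(d + e_v) − d + Σ_{l∈E} a_l`. [cite: Balaban1983Higgs3, (2.2) p.423] [cite: Balaban1983Higgs3, (2.14) p.427] -/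
def gdeg (Po : OutPairing G) (e : Fin G.nV → ℝ) (aL : Lines G Po → ℝ) (d : ℕ) (E : Finset (Lines G Po)) : ℝ :=
  (∑ v ∈ gverts Po E, ((d : ℝ) + e v)) - d + ∑ l ∈ E, aL l

/-- Adjacency of two vertices through a line of the set. [cite: Balaban1983Higgs3, Prop. 2.1 p.424] -/
def GAdj (Po : OutPairing G) (E : Finset (Lines G Po)) (a c : Fin G.nV) : Prop :=
  ∃ l ∈ E, lineSrc Po l = a ∧ lineTgt Po l = c

/-- A connected set of lines (*"connected subgraph"*): its lines connect its endpoint vertices. [cite: Balaban1983Higgs3, Prop. 2.1 p.424] -/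
def GConnected (Po : OutPairing G) (E : Finset (Lines G Po)) : Prop :=
  ∀ u ∈ gverts Po E, ∀ w ∈ gverts Po E, Relation.EqvGen (GAdj Po E) u w

variable (Po : OutPairing G) {m : ℕ} (eL : Fin m ≃ Lines G Po) (σ : Equiv.Perm (Fin m))
  (e : Fin G.nV → ℝ) (aL : Lines G Po → ℝ) (d L : ℕ) (δ₀ : ℝ) (hd : 0 < d) (hL : 2 ≤ L) (hδ : 0 < δ₀)

/-- The vertex set of a set of indices of the model listed along `σ` is the vertex set of the corresponding set of lines of `G`
(indices `i ↦ eL (σ i)`). [cite: Balaban1983Higgs3, (2.7) p.425] -/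
theorem verts_orderedModel (E : Finset (Fin m)) :
    verts (orderedModel G Po eL σ e aL d L δ₀ hd hL hδ) E = gverts Po (E.map (σ.trans eL).toEmbedding) := by
  ext v
  simp only [verts, gverts, mem_biUnion, mem_map, Equiv.toEmbedding_apply, Equiv.trans_apply]
  constructor
  · rintro ⟨l, hl, hv⟩
    exact ⟨eL (σ l), ⟨l, hl, rfl⟩, hv⟩
  · rintro ⟨l', ⟨l, hl, rfl⟩, hv⟩
    exact ⟨l, hl, hv⟩

/-- The generalized degree of a set of indices of the ordered model is that of the corresponding set of lines of `G`.
[cite: Balaban1983Higgs3, (2.2) p.423] [cite: Balaban1983Higgs3, (2.7) p.425] -/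
theorem lineSetDeg_orderedModel (E : Finset (Fin m)) :
    lineSetDeg (orderedModel G Po eL σ e aL d L δ₀ hd hL hδ) E = gdeg Po e aL d (E.map (σ.trans eL).toEmbedding) := by
  unfold lineSetDeg gdeg
  rw [verts_orderedModel, Finset.sum_map]
  rfl

/-- The adjacency relations agree. [cite: Balaban1983Higgs3, (2.7) p.425] -/
theorem adj_orderedModel_iff (E : Finset (Fin m)) (a c : Fin G.nV) :
    Adj (orderedModel G Po eL σ e aL d L δ₀ hd hL hδ) E a c ↔ GAdj Po (E.map (σ.trans eL).toEmbedding) a c := by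
  simp only [Adj, GAdj, mem_map, Equiv.toEmbedding_apply, Equiv.trans_apply]
  constructor
  · rintro ⟨l, hl, ha, hc⟩
    exact ⟨eL (σ l), ⟨l, hl, rfl⟩, ha, hc⟩
  · rintro ⟨l', ⟨l, hl, rfl⟩, ha, hc⟩
    exact ⟨l, hl, ha, hc⟩

/-- Connectedness of a set of indices of the ordered model is connectedness of the corresponding set of lines of `G`.
[cite: Balaban1983Higgs3, Prop. 2.1 p.424] [cite: Balaban1983Higgs3, (2.7) p.425] -/
theorem lconnected_orderedModel_iff (E : Finset (Fin m)) :
    LConnected (orderedModel G Po eL σ e aL d L δ₀ hd hL hδ) E ↔ GConnected Po (E.map (σ.trans eL).toEmbedding) := by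
  have hrel : Adj (orderedModel G Po eL σ e aL d L δ₀ hd hL hδ) E = GAdj Po (E.map (σ.trans eL).toEmbedding) := by
    funext a c
    exact propext (adj_orderedModel_iff Po eL σ e aL d L δ₀ hd hL hδ E a c)
  unfold LConnected GConnected
  rw [verts_orderedModel, hrel]

/-- **THE ORDERING-FREE HYPOTHESIS OF PROPOSITION 2.1 IMPLIES FILE 22's `PosDegAlong`**: if every nonempty connected set of lines of `G`
(with its endpoint vertices) has positive generalized degree `Σ_v(d + e_v) − d + Σ_l a_l` — print's *"each connected subgraph … has a
positive degree"* in the currency of (2.14) — then along EVERY ordering `σ` every component of every `G_i` has positive degree (§1 for the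
model listed along `σ`). [cite: Balaban1983Higgs3, Prop. 2.1 p.424] [cite: Balaban1983Higgs3, (2.16) p.428]
[cite: Balaban1983Higgs3, p.445] -/
theorem posDegAlong_of_forall_connected
    (H : ∀ E : Finset (Lines G Po), E.Nonempty → GConnected Po E → 0 < gdeg Po e aL d E) :
    PosDegAlong G Po eL e aL d L δ₀ hd hL hδ := by
  intro σ
  refine pos_blocks_of_forall_lineSets (orderedModel G Po eL σ e aL d L δ₀ hd hL hδ) fun E hE hc => ?_
  rw [lineSetDeg_orderedModel]
  exact H _ (by obtain ⟨l, hl⟩ := hE; exact ⟨_, Finset.mem_map_of_mem _ hl⟩)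
    ((lconnected_orderedModel_iff Po eL σ e aL d L δ₀ hd hL hδ E).1 hc)

end Graphs


/-! ## §3 (v1.1) The incidence dictionary: the generalized degree of a line set IS the printed (2.1)–(2.2) degree of the subgraph -/

section Incidence

open Literature.MathematicalPhysics.QuantumFieldTheory.Balaban1983to89.B3Ineq213VertexBounds (extraEta extraEta_eq)
open Literature.MathematicalPhysics.QuantumFieldTheory.Balaban1983to89.B3Ineq213TorusBlocksSigned (isDiffLeg)
open Literature.MathematicalPhysics.QuantumFieldTheory.Balaban1983to89.B3Ineq213ZeroBackground (nDiff lineDim)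
open Literature.MathematicalPhysics.QuantumFieldTheory.Balaban1983to89.B3Ineq213 (LinesConnect)
open Literature.MathematicalPhysics.QuantumFieldTheory.Balaban1983to89.B3Prop1 (VertexKind)
open Literature.MathematicalPhysics.QuantumFieldTheory.Balaban1983to89.B3Sect2Statements (Incidence degreeIn)
open Literature.MathematicalPhysics.QuantumFieldTheory.Balaban1983to89.B3VertexBridge (toCounts)

variable {nbar : ℕ} {G : Graph nbar} {P : HiggsLattice.Params} [DecidableEq (HiggsLattice.PBond P 0)]

/-- The number (0, 1 or 2) of φ′-legs of the vertex `v` on the line `l`, READ THROUGH THE LINE: its lower endpoint and the mate of it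
((2.1): *"the number of legs of scalar … fields in v belonging to internal lines of the graph"*, here of the subgraph).
[cite: Balaban1983Higgs3, (2.1) p.422] -/
def sInc (Po : OutPairing G) (v : Fin G.nV) : Lines G Po → ℕ
  | Sum.inl l => (if l.1.1 = v then 1 else 0) + (if ((sPairing G).mate l.1).1 = v then 1 else 0)
  | Sum.inr _ => 0

/-- The number of A′-legs of `v` on the line `l` ((2.1): *"… or vector fields in v belonging to internal lines"*). [cite: Balaban1983Higgs3, (2.1) p.422] -/
def vInc (Po : OutPairing G) (v : Fin G.nV) : Lines G Po → ℕ
  | Sum.inr (Sum.inl l) => (if l.1.1 = v then 1 else 0) + (if ((vPairing G).mate l.1).1 = v then 1 else 0)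
  | _ => 0

/-- The number of differentiations of `v` acting on the line `l` ((2.1): *"the number of differentiations in v acting on internal
lines"*), in the tree's vertex model: the differentiated legs are FILE 19's `isDiffLeg` (the `∂^η φ′`-leg of (1.8), (1.9)), counted at both
endpoints of a scalar line exactly as FILE 21's `nDiff`; none on vector lines and output pairs. [cite: Balaban1983Higgs3, (2.1) p.422] -/
def dInc (Po : OutPairing G) (v : Fin G.nV) : Lines G Po → ℕ
  | Sum.inl l => (if l.1.1 = v then (isDiffLeg (G.kind l.1.1) l.1.2).toNat else 0) +
      (if ((sPairing G).mate l.1).1 = v then (isDiffLeg (G.kind ((sPairing G).mate l.1).1) ((sPairing G).mate l.1).2).toNat else 0)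
  | Sum.inr _ => 0

/-- φ′-legs of `v` on the lines of the set `E`. [cite: Balaban1983Higgs3, (2.1) p.422] -/
def intS (Po : OutPairing G) (E : Finset (Lines G Po)) (v : Fin G.nV) : ℕ := ∑ l ∈ E, sInc Po v l

/-- A′-legs of `v` on the lines of `E`. [cite: Balaban1983Higgs3, (2.1) p.422] -/
def intV (Po : OutPairing G) (E : Finset (Lines G Po)) (v : Fin G.nV) : ℕ := ∑ l ∈ E, vInc Po v l

/-- Differentiations of `v` acting on the lines of `E`. [cite: Balaban1983Higgs3, (2.1) p.422] -/
def intD (Po : OutPairing G) (E : Finset (Lines G Po)) (v : Fin G.nV) : ℕ := ∑ l ∈ E, dInc Po v l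

/-- **(2.1) FOR THE SUBGRAPH SPANNED BY THE LINE SET `E`** (as printed, the incidences taken relative to the subgraph): `D_E(v) = (the
number of factors η in v) + (the number of legs of scalar or vector fields in v belonging to lines of E)·(−d+2)∕2 − (the number of
differentiations in v acting on lines of E) + [the number of legs of vector fields in v belonging to lines of E in the case when v is a vertex
of the form (1.14) and (1.15)]`; the η-count is r15's `etaCount` (p. 423 (i)–(v)), the incidences are read in p18's vertex model through
FILE 12's lines (`sInc`, `vInc`) and FILE 19's differentiated legs (`dInc`), the bracket by r15's `isAveragingVertex`.
[cite: Balaban1983Higgs3, (2.1) p.422] -/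
def vdeg (Po : OutPairing G) (d : ℕ) (E : Finset (Lines G Po)) (v : Fin G.nV) : ℝ :=
  ((G.kind v).etaCount d : ℝ) + ((intS Po E v + intV Po E v : ℕ) : ℝ) * ((2 - (d : ℝ)) / 2) - (intD Po E v : ℝ) +
    (if (G.kind v).isAveragingVertex then (intV Po E v : ℝ) else 0)

/-- The supplied dimension of an output pair (zero on the lines of p18's `Graph`): the (1.18) pairs are lines of the generalized graph of
FILE 12 ∕ 21 but not of the printed degree count (2.1)–(2.2). [cite: Balaban1983Higgs3, (2.14) p.427] [cite: Balaban1983Higgs3, (1.18) p.415] -/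
def outDim (Po : OutPairing G) (ao : Po.Line oRank → ℝ) : Lines G Po → ℝ
  | Sum.inr (Sum.inr o) => ao o
  | _ => 0

variable (Po : OutPairing G)

/-- The first endpoint of a line of `E` is a vertex of `E`. [cite: Balaban1983Higgs3, Prop. 2.1 p.425] -/
theorem lineSrc_mem_gverts {E : Finset (Lines G Po)} {l : Lines G Po} (hl : l ∈ E) : lineSrc Po l ∈ gverts Po E :=
  Finset.mem_biUnion.2 ⟨l, hl, by simp⟩

/-- The second endpoint of a line of `E` is a vertex of `E`. [cite: Balaban1983Higgs3, Prop. 2.1 p.425] -/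
theorem lineTgt_mem_gverts {E : Finset (Lines G Po)} {l : Lines G Po} (hl : l ∈ E) : lineTgt Po l ∈ gverts Po E :=
  Finset.mem_biUnion.2 ⟨l, hl, by simp⟩

/-- kernel: an indicator summed over a finite set containing its point. [folklore] -/
private theorem sum_ite_eq_of_mem {ι : Type*} [DecidableEq ι] {s : Finset ι} {a : ι} (h : a ∈ s) (c : ℝ) :
    ∑ x ∈ s, (if a = x then c else 0) = c := by
  rw [Finset.sum_ite_eq, if_pos h]

/-- **A LINE'S DIMENSION IS THE SUM OF ITS CONTRIBUTIONS TO THE DEGREES (2.1) OF ITS ENDPOINT VERTICES** (+ the supplied `a_o` for an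
output pair): summed over the vertices of `E`, the leg and differentiation counts of one line `l ∈ E` give FILE 21's `lineDim l`
(`2 − d − n_l` scalar, `2 − d` vector). [cite: Balaban1983Higgs3, (2.1) p.422] [cite: Balaban1983Higgs3, (2.14) p.427] -/
theorem sum_inc_eq_lineDim (d : ℕ) (ao : Po.Line oRank → ℝ) {E : Finset (Lines G Po)} {l : Lines G Po} (hl : l ∈ E) :
    ∑ v ∈ gverts Po E, (((sInc Po v l + vInc Po v l : ℕ) : ℝ) * ((2 - (d : ℝ)) / 2) - (dInc Po v l : ℝ)) +
        outDim Po ao l =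
      lineDim G Po d ao l := by
  have hs := lineSrc_mem_gverts Po hl
  have ht := lineTgt_mem_gverts Po hl
  rcases l with l | l | o
  · -- scalar line: two legs, `n_l` differentiations
    simp only [sInc, vInc, dInc, lineDim, nDiff, outDim, add_zero, Nat.cast_add, Nat.cast_ite, Nat.cast_one, Nat.cast_zero]
    rw [Finset.sum_sub_distrib, ← Finset.sum_mul, Finset.sum_add_distrib, Finset.sum_add_distrib]
    have h1 : ∑ x ∈ gverts Po E, (if l.1.1 = x then (1 : ℝ) else 0) = 1 := sum_ite_eq_of_mem hs 1
    have h2 : ∑ x ∈ gverts Po E, (if ((sPairing G).mate l.1).1 = x then (1 : ℝ) else 0) = 1 := sum_ite_eq_of_mem ht 1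
    have h3 : ∑ x ∈ gverts Po E, (if l.1.1 = x then ((isDiffLeg (G.kind l.1.1) l.1.2).toNat : ℝ) else 0) =
        ((isDiffLeg (G.kind l.1.1) l.1.2).toNat : ℝ) := sum_ite_eq_of_mem hs _
    have h4 : ∑ x ∈ gverts Po E, (if ((sPairing G).mate l.1).1 = x then
        ((isDiffLeg (G.kind ((sPairing G).mate l.1).1) ((sPairing G).mate l.1).2).toNat : ℝ) else 0) =
        ((isDiffLeg (G.kind ((sPairing G).mate l.1).1) ((sPairing G).mate l.1).2).toNat : ℝ) := sum_ite_eq_of_mem ht _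
    rw [h1, h2, h3, h4]
    ring
  · -- vector line: two legs
    simp only [sInc, vInc, dInc, lineDim, outDim, zero_add, add_zero, Nat.cast_add, Nat.cast_ite, Nat.cast_one, Nat.cast_zero, sub_zero]
    rw [← Finset.sum_mul, Finset.sum_add_distrib]
    have h1 : ∑ x ∈ gverts Po E, (if l.1.1 = x then (1 : ℝ) else 0) = 1 := sum_ite_eq_of_mem hs 1
    have h2 : ∑ x ∈ gverts Po E, (if ((vPairing G).mate l.1).1 = x then (1 : ℝ) else 0) = 1 := sum_ite_eq_of_mem ht 1
    rw [h1, h2]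
    ring
  · -- output pair: no legs of p18's graph; the supplied dimension
    simp [sInc, vInc, dInc, lineDim, outDim]

/-- **THE INCIDENCE DICTIONARY**: for every set of lines `E` of a graph of p18's model WITHOUT the vertices (1.14), (1.15) (FILE 21 ∕ 22's
scope `isAveragingVertex = false`, where FILE 21's `lineDim` gives every A′-leg the dimension `−(d−2)∕2`), FILE 22's generalized degree `gdeg`
with the η-powers `extraEta` (FILE 20: `etaCount − d`) and FILE 21's line dimensions `lineDim` IS the printed degree (2.2) of the subgraph
spanned by `E` — `Σ_{v ∈ verts E} D_E(v) − d` with the vertex degrees (2.1) `D_E(v)` computed from the incidences relative to `E` — plus the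
supplied dimensions of the output pairs in `E` (which are not lines of p18's `Graph`). [cite: Balaban1983Higgs3, (2.1) p.422]
[cite: Balaban1983Higgs3, (2.2) p.423] [cite: Balaban1983Higgs3, (2.14) p.427] -/
theorem gdeg_eq_sum_vdeg (hG : ∀ v, (G.kind v).isAveragingVertex = false) (d : ℕ) (ao : Po.Line oRank → ℝ)
    (E : Finset (Lines G Po)) :
    gdeg Po (fun v => ((extraEta (G.kind v) : ℤ) : ℝ)) (lineDim G Po d ao) d E =
      (∑ v ∈ gverts Po E, vdeg Po d E v) - d + ∑ l ∈ E, outDim Po ao l := by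
  -- no vertices (1.14), (1.15): the bracket of (2.1) vanishes
  have hb : ∀ v : Fin G.nV, (if (G.kind v).isAveragingVertex then (intV Po E v : ℝ) else 0) = 0 := fun v => by simp [hG v]
  unfold gdeg vdeg
  simp only [hb, add_zero]
  unfold intS intV intD
  -- η-powers: `d + extraEta = etaCount`
  have heta : ∀ v : Fin G.nV, (d : ℝ) + ((extraEta (G.kind v) : ℤ) : ℝ) = ((G.kind v).etaCount d : ℝ) := by
    intro v
    rw [extraEta_eq d]
    push_cast
    ring
  simp only [heta]
  -- the line dimensions, line by line
  have hlines : ∑ l ∈ E, lineDim G Po d ao l =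
      ∑ l ∈ E, (∑ v ∈ gverts Po E, (((sInc Po v l + vInc Po v l : ℕ) : ℝ) * ((2 - (d : ℝ)) / 2) - (dInc Po v l : ℝ)) +
        outDim Po ao l) :=
    Finset.sum_congr rfl fun l hl => (sum_inc_eq_lineDim Po d ao hl).symm
  rw [hlines, Finset.sum_add_distrib, Finset.sum_comm]
  -- regroup the vertex sums
  have hv : ∀ v ∈ gverts Po E,
      ((G.kind v).etaCount d : ℝ) + ((∑ l ∈ E, sInc Po v l + ∑ l ∈ E, vInc Po v l : ℕ) : ℝ) * ((2 - (d : ℝ)) / 2) -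
          ((∑ l ∈ E, dInc Po v l : ℕ) : ℝ) =
        ((G.kind v).etaCount d : ℝ) +
          ∑ l ∈ E, (((sInc Po v l + vInc Po v l : ℕ) : ℝ) * ((2 - (d : ℝ)) / 2) - (dInc Po v l : ℝ)) := by
    intro v _
    push_cast
    rw [Finset.sum_sub_distrib, ← Finset.sum_mul, Finset.sum_add_distrib]
    ring
  rw [Finset.sum_congr rfl hv, Finset.sum_add_distrib]
  ring

/-- **THE PRINTED HYPOTHESIS IN THE PRINTED CURRENCY ⇒ `PosDegAlong`**: for a graph without the vertices (1.14), (1.15), if every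
nonempty connected set of lines `E` of `G` has `Σ_{v ∈ verts E} D_E(v) − d + Σ_{output pairs o ∈ E} a_o(o) > 0` — the degree (2.1)–(2.2) of
the subgraph spanned by `E` (plus the supplied output-pair dimensions) — then FILE 22's per-ordering hypothesis holds for the η-powers
`extraEta` and the line dimensions `lineDim`, for every enumeration `eL`. [cite: Balaban1983Higgs3, Prop. 2.1 p.424]
[cite: Balaban1983Higgs3, (2.1) p.422] [cite: Balaban1983Higgs3, (2.2) p.423] -/
theorem posDegAlong_of_forall_connected_printed (hG : ∀ v, (G.kind v).isAveragingVertex = false) {m : ℕ}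
    (eL : Fin m ≃ Lines G Po) (d L : ℕ) (ao : Po.Line oRank → ℝ) (δ₀ : ℝ) (hd : 0 < d) (hL : 2 ≤ L) (hδ : 0 < δ₀)
    (H : ∀ E : Finset (Lines G Po), E.Nonempty → GConnected Po E →
      0 < (∑ v ∈ gverts Po E, vdeg Po d E v) - d + ∑ l ∈ E, outDim Po ao l) :
    PosDegAlong G Po eL (fun v => ((extraEta (G.kind v) : ℤ) : ℝ)) (lineDim G Po d ao) d L δ₀ hd hL hδ :=
  posDegAlong_of_forall_connected Po eL (fun v => ((extraEta (G.kind v) : ℤ) : ℝ)) (lineDim G Po d ao) d L δ₀ hd hL hδ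
    fun E hE hc => by rw [gdeg_eq_sum_vdeg Po hG]; exact H E hE hc

/-! ### §3b The whole graph: `E` = all lines recovers p18's incidence counts (2.1) and degree (2.2) -/

/-- **Both endpoints of all lines = all internal legs** (one species of legs): summing a function of the legs over the lower endpoint and
its mate, line by line, gives its sum over the internal legs (p. 415: *"every internal line has a vertex at each endpoint"*; an internal
leg is the lower endpoint of its line or the mate of it, not both — FILE 2's `lower_xor`). [cite: Balaban1983Higgs3, p.415] -/
theorem sum_line_ends {L : Type*} [Fintype L] [DecidableEq L] (Pr : Pairing L) {rank : L → ℕ} (hr : Function.Injective rank)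
    {M : Type*} [AddCommMonoid M] (f : L → M) :
    ∑ l : Pr.Line rank, (f l.1 + f (Pr.mate l.1)) = ∑ x ∈ Finset.univ.filter (fun x => (Pr.other x).isSome), f x := by
  classical
  rw [Finset.sum_add_distrib, ← Finset.sum_filter_add_sum_filter_not (Finset.univ.filter fun x => (Pr.other x).isSome)
    (fun x => Pr.isLower rank x = true) f, Finset.filter_filter, Finset.filter_filter]
  congr 1
  · -- the lower endpoints
    symm
    refine Finset.sum_subtype _ (fun x => ?_) f
    simp only [Finset.mem_filter, Finset.mem_univ, true_and]
    constructor
    · exact fun h => h.2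
    · intro h
      obtain ⟨y, hy, -⟩ := (Pr.isLower_iff rank x).1 h
      exact ⟨by rw [hy]; rfl, h⟩
  · -- the upper endpoints: `l ↦ mate l` is a bijection onto the internal legs that are not lower
    refine Finset.sum_bij (fun l _ => Pr.mate l.1) (fun l _ => ?_) (fun l₁ _ l₂ _ h => ?_) (fun x hx => ?_) (fun l _ => rfl)
    · have h1 : Pr.other (Pr.mate l.1) = some l.1 := Pr.other_mate_of_isLower rank l.2
      simp only [Finset.mem_filter, Finset.mem_univ, true_and]
      refine ⟨by rw [h1]; rfl, ?_⟩
      rcases Pr.lower_xor rank hr h1 with ⟨-, h2⟩ | ⟨h2, -⟩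
      · exact absurd l.2 (by simp [h2])
      · simp [h2]
    · have e1 : Pr.other (Pr.mate l₁.1) = some l₁.1 := Pr.other_mate_of_isLower rank l₁.2
      have e2 : Pr.other (Pr.mate l₂.1) = some l₂.1 := Pr.other_mate_of_isLower rank l₂.2
      rw [h, e2] at e1
      exact Subtype.ext (Option.some.inj e1).symm
    · simp only [Finset.mem_filter, Finset.mem_univ, true_and] at hx
      obtain ⟨hs, hnl⟩ := hx
      obtain ⟨y, hy⟩ := Option.isSome_iff_exists.1 hs
      rcases Pr.lower_xor rank hr hy with ⟨hxl, -⟩ | ⟨-, hyl⟩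
      · exact absurd hxl hnl
      · exact ⟨⟨y, hyl⟩, Finset.mem_univ _, Pr.mate_eq (Pr.symm x y hy)⟩

/-- a φ′-leg is internal for FILE 12's scalar pairing iff it is internal in p18's graph. [cite: Balaban1983Higgs3, p.415] -/
theorem sOther_isSome_iff (x : SLeg G.kind) : ((sPairing G).other x).isSome = true ↔ (G.other x.toLeg).isSome = true := by
  rw [Option.isSome_iff_ne_none, Option.isSome_iff_ne_none, ne_eq, ne_eq, show (sPairing G).other x = spartner G x from rfl,
    spartner_eq_none_iff]

/-- an A′-leg is internal for FILE 12's vector pairing iff it is internal in p18's graph. [cite: Balaban1983Higgs3, p.415] -/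
theorem vOther_isSome_iff (x : VLeg G.kind) : ((vPairing G).other x).isSome = true ↔ (G.other x.toLeg).isSome = true := by
  rw [Option.isSome_iff_ne_none, Option.isSome_iff_ne_none, ne_eq, ne_eq, show (vPairing G).other x = vpartner G x from rfl,
    vpartner_eq_none_iff]

/-- kernel: the differentiated legs of FILE 19 counted with p18's `diffCount` — the `∂^η φ′` of (1.8), (1.9) acts on the first φ′-leg.
[cite: Balaban1983Higgs3, (1.8) p.413] -/
theorem isDiffLeg_toNat (κ : VertexKind) (j : Fin κ.scalarLegs) : (isDiffLeg κ j).toNat = if j.val = 0 then κ.diffCount else 0 := by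
  cases κ <;> by_cases h : j.val = 0 <;> simp [isDiffLeg, VertexKind.diffCount, h]

/-- kernel: a sum over the legs supported on the leg `0`. [folklore] -/
private theorem sum_leg_zero (N c : ℕ) (int : Fin N → Bool) :
    (∑ j : Fin N, if int j = true then (if j.val = 0 then c else 0) else 0) =
      if h : 0 < N then (if int ⟨0, h⟩ = true then c else 0) else 0 := by
  by_cases hN : 0 < N
  · rw [dif_pos hN, Finset.sum_eq_single ⟨0, hN⟩]
    · simp
    · intro j _ hj
      have : j.val ≠ 0 := fun e => hj (Fin.ext e)
      simp [this]
    · exact fun h => absurd (Finset.mem_univ _) h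
  · rw [dif_neg hN]
    obtain rfl : N = 0 := by omega
    simp

/-- **(2.1) RECOVERED ON THE WHOLE GRAPH, φ′-LEGS**: with `E` = all lines, the φ′-legs of `v` read through the lines are p18's
*"number of φ′-legs of the vertex lying on internal lines of G"* (`Graph.intScalar`). [cite: Balaban1983Higgs3, (2.1) p.422] -/
theorem intS_univ (v : Fin G.nV) : intS Po Finset.univ v = G.intScalar v := by
  have h := sum_line_ends (sPairing G) sRank_injective (fun x : SLeg G.kind => if x.1 = v then (1 : ℕ) else 0)
  beta_reduce at h
  unfold intS
  rw [Fintype.sum_sum_type]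
  simp only [sInc, Finset.sum_const_zero, add_zero]
  rw [h, Finset.sum_filter, Fintype.sum_sigma, Finset.sum_eq_single v (fun i _ hi => Finset.sum_eq_zero fun j _ => by simp [hi])
    (fun hv => absurd (Finset.mem_univ v) hv)]
  unfold Graph.intScalar
  rw [Finset.card_filter]
  refine Finset.sum_congr rfl fun j _ => ?_
  simp only [sOther_isSome_iff, if_true]
  rfl

/-- **(2.1) RECOVERED ON THE WHOLE GRAPH, A′-LEGS** (`Graph.intVector`). [cite: Balaban1983Higgs3, (2.1) p.422] -/
theorem intV_univ (v : Fin G.nV) : intV Po Finset.univ v = G.intVector v := by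
  have h := sum_line_ends (vPairing G) vRank_injective (fun x : VLeg G.kind => if x.1 = v then (1 : ℕ) else 0)
  beta_reduce at h
  unfold intV
  rw [Fintype.sum_sum_type, Fintype.sum_sum_type]
  simp only [vInc, Finset.sum_const_zero, add_zero, zero_add]
  rw [h, Finset.sum_filter, Fintype.sum_sigma, Finset.sum_eq_single v (fun i _ hi => Finset.sum_eq_zero fun j _ => by simp [hi])
    (fun hv => absurd (Finset.mem_univ v) hv)]
  unfold Graph.intVector
  rw [Finset.card_filter]
  refine Finset.sum_congr rfl fun j _ => ?_
  simp only [vOther_isSome_iff, if_true]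
  rfl

/-- **(2.1) RECOVERED ON THE WHOLE GRAPH, DIFFERENTIATIONS** (`Graph.intDiffs`: the differentiation of (1.8), (1.9) acts on an internal line
iff the first φ′-leg is internal). [cite: Balaban1983Higgs3, (2.1) p.422] -/
theorem intD_univ (v : Fin G.nV) : intD Po Finset.univ v = G.intDiffs v := by
  have h := sum_line_ends (sPairing G) sRank_injective
    (fun x : SLeg G.kind => if x.1 = v then (isDiffLeg (G.kind x.1) x.2).toNat else 0)
  beta_reduce at h
  unfold intD
  rw [Fintype.sum_sum_type]
  simp only [dInc, Finset.sum_const_zero, add_zero]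
  rw [h, Finset.sum_filter, Fintype.sum_sigma, Finset.sum_eq_single v (fun i _ hi => Finset.sum_eq_zero fun j _ => by simp [hi])
    (fun hv => absurd (Finset.mem_univ v) hv)]
  unfold Graph.intDiffs
  simp only [if_true, isDiffLeg_toNat, sOther_isSome_iff]
  exact sum_leg_zero _ _ fun j => (G.other ⟨v, Sum.inl j⟩).isSome

/-- **THE VERTEX DEGREE (2.1) OF p18 IS `vdeg` AT `E` = ALL LINES**: `vdeg Po d univ v = D_G(v)` (`Graph.vertexDeg`, ℚ-valued in p18).
[cite: Balaban1983Higgs3, (2.1) p.422] -/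
theorem vdeg_univ (d : ℕ) (v : Fin G.nV) : vdeg Po d Finset.univ v = ((G.vertexDeg d v : ℚ) : ℝ) := by
  rw [vdeg, intS_univ, intV_univ, intD_univ, G.vertexDeg_eq d v]
  split_ifs <;> push_cast <;> ring

/-- **THE DEGREE (2.2) OF p18 IS `Σ_v vdeg − d` AT `E` = ALL LINES**: `Σ_v D_G(v) − d = D(G)` (`Graph.deg`, `Graph.deg_eq`).
[cite: Balaban1983Higgs3, (2.2) p.423] -/
theorem sum_vdeg_univ_sub (d : ℕ) : (∑ v : Fin G.nV, vdeg Po d Finset.univ v) - d = ((G.deg d : ℚ) : ℝ) := by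
  simp only [vdeg_univ]
  rw [G.deg_eq d]
  push_cast
  ring

/-- A graph of p18's model has a line (*"There is at least one internal line"*, `Graph.exists_line`), hence a line of FILE 12's `Lines`.
[cite: Balaban1983Higgs3, p.415] -/
theorem lines_nonempty : Nonempty (Lines G Po) := by
  obtain ⟨⟨i, s⟩, hx⟩ := G.exists_line
  obtain ⟨y, hy⟩ := Option.isSome_iff_exists.1 hx
  rcases s with j | j
  · have h1 : ((sPairing G).other ⟨i, j⟩).isSome = true := by
      rw [sOther_isSome_iff]
      exact Option.isSome_iff_exists.2 ⟨y, hy⟩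
    obtain ⟨z, hz⟩ := Option.isSome_iff_exists.1 h1
    rcases (sPairing G).lower_xor sRank sRank_injective hz with ⟨hl, -⟩ | ⟨-, hl⟩
    · exact ⟨Sum.inl ⟨⟨i, j⟩, hl⟩⟩
    · exact ⟨Sum.inl ⟨z, hl⟩⟩
  · have h1 : ((vPairing G).other ⟨i, j⟩).isSome = true := by
      rw [vOther_isSome_iff]
      exact Option.isSome_iff_exists.2 ⟨y, hy⟩
    obtain ⟨z, hz⟩ := Option.isSome_iff_exists.1 h1
    rcases (vPairing G).lower_xor vRank vRank_injective hz with ⟨hl, -⟩ | ⟨-, hl⟩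
    · exact ⟨Sum.inr (Sum.inl ⟨⟨i, j⟩, hl⟩)⟩
    · exact ⟨Sum.inr (Sum.inl ⟨z, hl⟩)⟩

/-- **IN A CONNECTED GRAPH EVERY VERTEX IS AN ENDPOINT OF A LINE** (Proposition 2.1: *"Let G be a connected graph"* — FILE 22's hypothesis
`LinesConnect` along an enumeration of the lines). [cite: Balaban1983Higgs3, Prop. 2.1 p.424] -/
theorem exists_endpoint_of_linesConnect {m : ℕ} (eL : Fin m ≃ Lines G Po)
    (hconn : LinesConnect (fun i => lineSrc Po (eL i)) (fun i => lineTgt Po (eL i))) (v : Fin G.nV) :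
    ∃ l : Lines G Po, lineSrc Po l = v ∨ lineTgt Po l = v := by
  by_cases hw : ∃ w : Fin G.nV, w ≠ v
  · obtain ⟨w, hw⟩ := hw
    have key : ∀ u w : Fin G.nV, Relation.EqvGen (fun a b => ∃ i, lineSrc Po (eL i) = a ∧ lineTgt Po (eL i) = b) u w →
        u = w ∨ ((∃ l : Lines G Po, lineSrc Po l = u ∨ lineTgt Po l = u) ∧ (∃ l : Lines G Po, lineSrc Po l = w ∨ lineTgt Po l = w)) := by
      intro u w h
      induction h with
      | rel a b hab =>
        obtain ⟨i, ha, hb⟩ := hab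
        exact Or.inr ⟨⟨eL i, Or.inl ha⟩, ⟨eL i, Or.inr hb⟩⟩
      | refl a => exact Or.inl rfl
      | symm a b _ ih =>
        rcases ih with e | ⟨ha, hb⟩
        · exact Or.inl e.symm
        · exact Or.inr ⟨hb, ha⟩
      | trans a b c _ _ ih1 ih2 =>
        rcases ih1 with e1 | ⟨ha, hb⟩
        · subst e1; exact ih2
        · rcases ih2 with e2 | ⟨-, hc⟩
          · subst e2; exact Or.inr ⟨ha, hb⟩
          · exact Or.inr ⟨ha, hc⟩
    rcases key v w (hconn v w) with e | ⟨hv, -⟩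
    · exact absurd e.symm hw
    · exact hv
  · push Not at hw
    obtain ⟨l⟩ := lines_nonempty Po
    exact ⟨l, Or.inl (hw _)⟩

/-- In a connected graph the vertices of the set of ALL lines are all the vertices. [cite: Balaban1983Higgs3, Prop. 2.1 p.424] -/
theorem gverts_univ_of_linesConnect {m : ℕ} (eL : Fin m ≃ Lines G Po)
    (hconn : LinesConnect (fun i => lineSrc Po (eL i)) (fun i => lineTgt Po (eL i))) :
    gverts Po (Finset.univ : Finset (Lines G Po)) = Finset.univ := by
  refine Finset.eq_univ_iff_forall.2 fun v => ?_
  obtain ⟨l, hl | hl⟩ := exists_endpoint_of_linesConnect Po eL hconn v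
  · exact hl ▸ lineSrc_mem_gverts Po (Finset.mem_univ l)
  · exact hl ▸ lineTgt_mem_gverts Po (Finset.mem_univ l)

/-- **THE DICTIONARY ON THE WHOLE GRAPH**: for a connected graph of p18's model without the vertices (1.14), (1.15), FILE 22's generalized
degree of the set of ALL lines, with the η-powers `extraEta` and FILE 21's `lineDim`, is p18's degree `D(G)` of (2.2) (`Graph.deg`) plus
the supplied dimensions of the (1.18) output pairs. [cite: Balaban1983Higgs3, (2.2) p.423] [cite: Balaban1983Higgs3, (2.14) p.427] -/
theorem gdeg_univ_eq_deg (hG : ∀ v, (G.kind v).isAveragingVertex = false) {m : ℕ} (eL : Fin m ≃ Lines G Po)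
    (hconn : LinesConnect (fun i => lineSrc Po (eL i)) (fun i => lineTgt Po (eL i))) (d : ℕ) (ao : Po.Line oRank → ℝ) :
    gdeg Po (fun v => ((extraEta (G.kind v) : ℤ) : ℝ)) (lineDim G Po d ao) d Finset.univ =
      ((G.deg d : ℚ) : ℝ) + ∑ o : Po.Line oRank, ao o := by
  rw [gdeg_eq_sum_vdeg Po hG, gverts_univ_of_linesConnect Po eL hconn, sum_vdeg_univ_sub]
  congr 1
  rw [Fintype.sum_sum_type, Fintype.sum_sum_type]
  simp [outDim]

/-! ### §3c `vdeg` IS r15 ∕ p18's `degreeIn` (2.1) fed with the incidence record RELATIVE TO THE LINE SET -/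

/-- more lines, more φ′-leg incidences. [cite: Balaban1983Higgs3, (2.1) p.422] -/
theorem intS_mono {E F : Finset (Lines G Po)} (h : E ⊆ F) (v : Fin G.nV) : intS Po E v ≤ intS Po F v :=
  Finset.sum_le_sum_of_subset h

/-- more lines, more A′-leg incidences. [cite: Balaban1983Higgs3, (2.1) p.422] -/
theorem intV_mono {E F : Finset (Lines G Po)} (h : E ⊆ F) (v : Fin G.nV) : intV Po E v ≤ intV Po F v :=
  Finset.sum_le_sum_of_subset h

/-- more lines, more differentiations acting on them. [cite: Balaban1983Higgs3, (2.1) p.422] -/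
theorem intD_mono {E F : Finset (Lines G Po)} (h : E ⊆ F) (v : Fin G.nV) : intD Po E v ≤ intD Po F v :=
  Finset.sum_le_sum_of_subset h

/-- The φ′-legs of `v` on the lines of `E` are among its φ′-legs (print: the incidences of (2.1) are *"each at most the corresponding
total"* — r15's `Incidence.hScalar`). [cite: Balaban1983Higgs3, (2.1) p.422] -/
theorem intS_le_scalarLegs (E : Finset (Lines G Po)) (v : Fin G.nV) : intS Po E v ≤ (G.kind v).scalarLegs :=
  (intS_mono Po (Finset.subset_univ E) v).trans (((intS_univ Po v).le).trans (G.intScalar_le v))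

/-- The A′-legs of `v` on the lines of `E` are among its A′-legs (`Incidence.hVector`). [cite: Balaban1983Higgs3, (2.1) p.422] -/
theorem intV_le_vectorLegs (E : Finset (Lines G Po)) (v : Fin G.nV) : intV Po E v ≤ (G.kind v).vectorLegs :=
  (intV_mono Po (Finset.subset_univ E) v).trans (((intV_univ Po v).le).trans (G.intVector_le v))

/-- The differentiations of `v` acting on lines of `E` are among its differentiations (`Incidence.hDiffs`). [cite: Balaban1983Higgs3, (2.1) p.422] -/
theorem intD_le_diffCount (E : Finset (Lines G Po)) (v : Fin G.nV) : intD Po E v ≤ (G.kind v).diffCount :=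
  (intD_mono Po (Finset.subset_univ E) v).trans (((intD_univ Po v).le).trans (G.intDiffs_le v))

/-- **THE INCIDENCE RECORD (2.1) OF A VERTEX RELATIVE TO A LINE SET** — r15's `B3Sect2Statements.Incidence` for the counts `toCounts` of the
vertex, filled with the incidences on the lines of `E` (p18's `Graph.incidence` is the case `E` = all lines: `intS_univ`, `intV_univ`,
`intD_univ`). [cite: Balaban1983Higgs3, (2.1) p.422] -/
def incidenceOf (d : ℕ) (E : Finset (Lines G Po)) (v : Fin G.nV) : Incidence (toCounts d (G.kind v)) :=
  ⟨intS Po E v, intV Po E v, intD Po E v, intS_le_scalarLegs Po E v, intV_le_vectorLegs Po E v, intD_le_diffCount Po E v⟩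

/-- **`vdeg` = `degreeIn`**: the vertex degree (2.1) relative to the line set `E` is r15's verbatim (2.1) `degreeIn` evaluated at the vertex's
counts and the incidence record relative to `E` (ℚ-valued there). [cite: Balaban1983Higgs3, (2.1) p.422] -/
theorem vdeg_eq_degreeIn (d : ℕ) (E : Finset (Lines G Po)) (v : Fin G.nV) :
    vdeg Po d E v = ((degreeIn d (toCounts d (G.kind v)) (incidenceOf Po d E v) : ℚ) : ℝ) := by
  unfold vdeg degreeIn incidenceOf toCounts
  split_ifs <;> push_cast <;> ring

/-- At `E` = all lines the record is p18's `Graph.incidence` and `degreeIn` is p18's `Graph.vertexDeg` (consistency of the two readings).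
[cite: Balaban1983Higgs3, (2.1) p.422] -/
theorem incidenceOf_univ (d : ℕ) (v : Fin G.nV) : incidenceOf Po d Finset.univ v = G.incidence d v := by
  unfold incidenceOf Graph.incidence
  congr 1
  · exact intS_univ Po v
  · exact intV_univ Po v
  · exact intD_univ Po v

end Incidence

end

end Literature.MathematicalPhysics.QuantumFieldTheory.Balaban1983to89.B3Prop21DegreeHypothesis
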